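import Summits.HodgeConjecture.HodgeConjecture.Theorems.F0P2oD7alphaMemDockOfRows              -- ★ p839985 (F0P2-p01 (g9)): §1 `lawsV8_kitFamilyOfRecord_of_rows`, `mem_packFin_of_rows` (MEM at the rows)
import Summits.HodgeConjecture.HodgeConjecture.Theorems.F0P2oD7alphaMemDockStatement           -- ED. 2 (F0P2-p01 (g9)): the packet-level Test node `StubD7αMemDockPerMeasureT`
import Summits.HodgeConjecture.HodgeConjecture.Theorems.F0P2oCharIdentityCompletionUniqueTest -- ★ p840326 (F0P2-p06 (g5), ED. 2): DOCKᵀ junction `cmThetaDockingClausesTest_of_thetaWitness`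
import Literature.NumberTheory.GelbartRogawski1991.PiSCompletionIsThetaTypeTest           -- ★ p840297 (F0P2-p01 (g9), T-2): the print letter (D-b)ᵀ ON TEST FUNCTIONS
import HarnessLib

/-!
# Crux `H413`, programme P2 — (D7α-J) PRODUCER, TEST EDITION: the packet-level node `StubD7αMemDockPerMeasureT` AT THE ROWS OF A KIT FAMILY OF RECORD
# (MEM from the fourteen rows ★ p839985 §1; SHAPE + Haar + transfer existence + (D-b)ᵀ as record hypotheses; DOCKᵀ via ★ p840326; Lines-free, assembly only)

Cell `hodgecm-mathlib` (D-0151), FLOOR 0, crux item H413 = `stmt-HodgeConjecture-24833`, route of record `HCCMUnconditional`; programme P2, fallback road PKΠ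
`Cruxes/H413/Lines/F0_P2PKPiRung4.lean` (v1.14 → v1.15 «DOCK-T», desk F0P2-plan (g9)).  F0P2-p01 (g9); desk RULING 2026-09-01T02:57:40Z («D7α NODE ED. 2 PACKET-LEVEL,
R4-FREE» = node of record) (f); F0P2-ref1 (g6) r247 (5).  The Test-currency successor of ★ p839985 §2 `stubD7αMemDockPerMeasure_of_rows` (kept there as the negative
edge: its H₇ ∧ H₈ are jointly unsatisfiable at record data — F0P2-p06 (g5) certificate ★ p840179, T8-21 ∕ director s759).  Separate module (not an ED. 2 of ★ p839985) only to
keep both files under the 400-line mark; nothing in ★ p839985 changes.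
Helper file: THEOREMS ONLY (no definition, no named fact, no instance declaration or attribute, no notation, no `sorry`); `--supports stmt-HodgeConjecture-24833 --as helper`.
HONEST LABEL: HC_CM is proved only modulo the printed citations until rung 0 closes; this file discharges none of them — its hypotheses are the closer's fourteen ROWS at a
`FrameData` family, the record data with their SHAPE ∕ Haar ∕ transfer-existence clauses, and the print letter (D-b)ᵀ; it is instantiated only where the rung-0 choice is in
scope (the closer's §D, F0P3 pen).

References: [Rogawski1990] §13.1 Prop. 13.1.3 (d), Prop. 13.1.4 p. 199; §12.2 (2) pp. 173–174; Thm. 13.3.7; §14.6 Thm. 14.6.4 pp. 244–246; §4.9 Prop. 4.9.1 (a) p. 55.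
[GelbartRogawski1991] Lem. 5.1.2 p. 466; Thm. 5.1.1 p. 465.  [Zelevinsky1980] Thm. 4.2.
-/

set_option autoImplicit false
-- the mandated namespace repeats `HodgeConjecture.HodgeConjecture`, as in every `Theorems/*.lean` of this sub-problem
set_option linter.dupNamespace false

noncomputable section

open NumberField IsDedekindDomain MeasureTheory
open scoped Matrix ComplexOrder

namespace Summit.HodgeConjecture.HodgeConjecture.Cruxes.H413.F0P2oD7alphaMemDockOfRowsT

open Literature.NumberTheory.Rogawski1990 Literature.NumberTheory.GaloisRepresentations
open Literature.NumberTheory.Automorphic Literature.NumberTheory.Automorphic.UnitaryGroup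
open Literature.NumberTheory.Automorphic.UnitaryGroup.CotangentForms
open Literature.RepresentationTheory.BorelWallach2000 Literature.RepresentationTheory.KonnoKonno2007
open Summit.HodgeConjecture.HodgeConjecture.Cruxes.H413.F0P3InnerFormClassificationV6 (Gp Places)
open Summit.HodgeConjecture.HodgeConjecture.Cruxes.H413.F0P3KitOfRecord (FrameData kitFamilyOfRecord)
open Summit.HodgeConjecture.HodgeConjecture.Cruxes.H413.F0P3XiArchPacketOfRecord (JInfNoDegOne DsInfNoDegOne)
open Summit.HodgeConjecture.HodgeConjecture.Cruxes.H413.F0P2oD7alphaMemDockOfRows (mem_packFin_of_rows)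

/-! ## §1 THE PACKET-LEVEL TEST NODE `StubD7αMemDockPerMeasureT` FROM THE ROWS AND THE RECORD DATA -/

section PerMeasureT

variable
  (𝔇 : ∀ (L : Type) [Field L] [NumberField L] [IsCMField L] (ι : L →+* ℂ) (H : Matrix (Fin 3) (Fin 3) L) (T : GL (Fin 3) ℂ)
    (hT : (T : Matrix (Fin 3) (Fin 3) ℂ)ᴴ * H.map ι * (T : Matrix (Fin 3) (Fin 3) ℂ) = Literature.Geometry.ComplexHyperbolic.BallModel.J),
    (∀ τ' : L →+* ℂ, InfinitePlace.mk τ' ≠ InfinitePlace.mk ι → (H.map τ').PosDef) →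
    2 ≤ Module.finrank ℚ ↥(maximalRealSubfield L) →
    ∀ (μ : Measure (Gp L H).automorphicQuotient) [(Gp L H).IsAutomorphicMeasure μ] (μω : HeckeCharacter L) (_hμu : μω.IsUnitary),
    (∀ x : Literature.NumberTheory.GaloisRepresentations.ideleGroup ↥(maximalRealSubfield L),
      μω (AdeleRing.ideleBaseChange (↥(maximalRealSubfield L)) L x) = quadraticHeckeCharCM L x) → FrameData L H ι T hT μ)
  (h : ∀ (L : Type) [Field L] [NumberField L] [IsCMField L] (ι : L →+* ℂ) (H : Matrix (Fin 3) (Fin 3) L) (T : GL (Fin 3) ℂ)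
    (hT : (T : Matrix (Fin 3) (Fin 3) ℂ)ᴴ * H.map ι * (T : Matrix (Fin 3) (Fin 3) ℂ) = Literature.Geometry.ComplexHyperbolic.BallModel.J)
    (hdef : ∀ τ' : L →+* ℂ, InfinitePlace.mk τ' ≠ InfinitePlace.mk ι → (H.map τ').PosDef) (h2 : 2 ≤ Module.finrank ℚ ↥(maximalRealSubfield L))
    (μ : Measure (Gp L H).automorphicQuotient) [(Gp L H).IsAutomorphicMeasure μ] (μω : HeckeCharacter L) (hμu : μω.IsUnitary)
    (hμω : ∀ x : Literature.NumberTheory.GaloisRepresentations.ideleGroup ↥(maximalRealSubfield L),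
      μω (AdeleRing.ideleBaseChange (↥(maximalRealSubfield L)) L x) = quadraticHeckeCharCM L x),
    ∃ S₀ : Finset (Places L),
    F0P3InnerFormClassificationV8.ClassificationKit.SpecPkg (kitFamilyOfRecord 𝔇 L ι H T hT hdef h2 μ μω hμu hμω) S₀ ∧
    (kitFamilyOfRecord 𝔇 L ι H T hT hdef h2 μ μω hμu hμω).TraceIdentity ∧
    F0P3InnerFormClassificationV8.ClassificationKit.FactorisationCls (kitFamilyOfRecord 𝔇 L ι H T hT hdef h2 μ μω hμu hμω) S₀ ∧
    (kitFamilyOfRecord 𝔇 L ι H T hT hdef h2 μ μω hμu hμω).SpectralSideGp ∧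
    F0P3InnerFormClassificationV8.ClassificationKit.HatBounded (kitFamilyOfRecord 𝔇 L ι H T hT hdef h2 μ μω hμu hμω) S₀ ∧
    F0P3InnerFormClassificationV8.ClassificationKit.UnrStarAlgebra (kitFamilyOfRecord 𝔇 L ι H T hT hdef h2 μ μω hμu hμω) S₀ ∧
    (kitFamilyOfRecord 𝔇 L ι H T hT hdef h2 μ μω hμu hμω).LinIndepS ∧
    F0P3InnerFormClassificationV8.ClassificationKit.UnitaryPacket (kitFamilyOfRecord 𝔇 L ι H T hT hdef h2 μ μω hμu hμω) S₀ ∧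
    (kitFamilyOfRecord 𝔇 L ι H T hT hdef h2 μ μω hμu hμω).Routing ∧
    JInfNoDegOne (𝔇 L ι H T hT hdef h2 μ μω hμu hμω).jInf ∧ DsInfNoDegOne (𝔇 L ι H T hT hdef h2 μ μω hμu hμω).dsInf ∧
    (kitFamilyOfRecord 𝔇 L ι H T hT hdef h2 μ μω hμu hμω).XiFamilyFin μω hμu ∧
    (kitFamilyOfRecord 𝔇 L ι H T hT hdef h2 μ μω hμu hμω).XiUnram ∧
    (kitFamilyOfRecord 𝔇 L ι H T hT hdef h2 μ μω hμu hμω).EvpConvention)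

include h in
/-- **`StubD7αMemDockPerMeasureT` FROM THE ROWS AND THE RECORD DATA (assembly only).**  The Test ∕ packet-level twin of ★ p839985 §2: hypotheses H₁ `𝔇`, H₂ `h` (the fourteen
rows) and — bundled per frame AND per measure into ONE hypothesis `hrecT`, over record data `(Δ, mH, mG, νG, νH, μZ)` — (H₄ᵀ) the SHAPE of the kit family's finite packets at
non-split places (`(kitFamilyOfRecord 𝔇 …).packFin ξ v = ⟨πⁿ ∘ e, some πˢ⟩` with Keys labels, `πˢ` supercuspidal `≠ πⁿ ∘ e`, and the identity (13.1.4) ON TEST FUNCTIONS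
★ `LocalAPacket.CharIdentityAtTest` for that packet — at the closer this is `xiPacketFamilyOfRecord_of_nonsplit` + the Keys data + the repaired `hCM`∕`hSC` accessors),
(H₅)(H₆) Haar `μZ v`, `νG v`, (H₇) test-function transfer existence ★ `IsLocalDeltaTransferExists … IsLocSmooth IsLocSmooth` at non-split `v`, (H₈ᵀ) the print letter (D-b)ᵀ
★ `GelbartRogawski1991.piSCompletion_isThetaTypeAtCMTest` BY NAME (p840297).  Conclusion: the node of record ★ `F0P2oD7alphaMemDockStatement.StubD7αMemDockPerMeasureT` BY NAME
(ED. 2 of the statement file).  Proof: `packFin := (kitFamilyOfRecord 𝔇 …).packFin`, `ξloc := fun ξ v => ξ.xiLocalChar v`; DOCKᵀ = ★ p840326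
`F0P2oCharIdentityCompletionUniqueTest.cmThetaDockingClausesTest_of_thetaWitness … hex hW`; SHAPE = H₄ᵀ; MEM_μ = ★ p839985 §1 `mem_packFin_of_rows` (no rewriting: the packet IS the kit's).
No hypothesis of the pre-repair forms `CMNonsplitCharIdentityAt` ∕ `CMThetaDockingClauses` ∕ (D-b)-as-typed (F0P2-ref1 (g6) r247 (5)).
[cite: Rogawski1990, §13.1 Prop. 13.1.3 (d), Prop. 13.1.4 p. 199; §12.2 (2) pp. 173–174; Thm. 13.3.7; §14.6 Thm. 14.6.4 pp. 244–246; §4.9 Prop. 4.9.1 (a) p. 55]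
[cite: GelbartRogawski1991, Lem. 5.1.2 p. 466; Thm. 5.1.1 p. 465] [cite: Zelevinsky1980, Thm. 4.2] -/
theorem stubD7αMemDockPerMeasureT_of_rows
  (hrecT : ∀ (L : Type) [Field L] [NumberField L] [IsCMField L] (ι : L →+* ℂ) (H : Matrix (Fin 3) (Fin 3) L) (T : GL (Fin 3) ℂ)
    (hT : (T : Matrix (Fin 3) (Fin 3) ℂ)ᴴ * H.map ι * (T : Matrix (Fin 3) (Fin 3) ℂ) = Literature.Geometry.ComplexHyperbolic.BallModel.J)
    (hdef : ∀ τ' : L →+* ℂ, InfinitePlace.mk τ' ≠ InfinitePlace.mk ι → (H.map τ').PosDef) (h2 : 2 ≤ Module.finrank ℚ ↥(maximalRealSubfield L))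
    (μω : HeckeCharacter L) (hμu : μω.IsUnitary)
    (hμω : ∀ x : Literature.NumberTheory.GaloisRepresentations.ideleGroup ↥(maximalRealSubfield L), μω (AdeleRing.ideleBaseChange (↥(maximalRealSubfield L)) L x) = quadraticHeckeCharCM L x)
    (μ : Measure (adelicGroupData (↥(maximalRealSubfield L)) L (IsCMField.complexConj L) 3 H).automorphicQuotient) [(adelicGroupData (↥(maximalRealSubfield L)) L (IsCMField.complexConj L) 3 H).IsAutomorphicMeasure μ],
    letI : ∀ v : HeightOneSpectrum (𝓞 ↥(maximalRealSubfield L)), MeasurableSpace ((cmDatum L 3 H).Local v) := fun _ => borel _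
    letI : ∀ v : HeightOneSpectrum (𝓞 ↥(maximalRealSubfield L)),
        MeasurableSpace ((cmDatum L 2 (Matrix.of fun i j : Fin 2 => if i.val + j.val + 1 = 2 then (1 : L) else 0)).Local v ×
          (cmDatum L 1 (Matrix.of fun i j : Fin 1 => if i.val + j.val + 1 = 1 then (1 : L) else 0)).Local v) := fun _ => borel _
    letI : ∀ (v : HeightOneSpectrum (𝓞 ↥(maximalRealSubfield L)))
        (a : ((cmDatum L 2 (Matrix.of fun i j : Fin 2 => if i.val + j.val + 1 = 2 then (1 : L) else 0)).Local v ×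
          (cmDatum L 1 (Matrix.of fun i j : Fin 1 => if i.val + j.val + 1 = 1 then (1 : L) else 0)).Local v)),
        MeasurableSpace (((cmDatum L 2 (Matrix.of fun i j : Fin 2 => if i.val + j.val + 1 = 2 then (1 : L) else 0)).Local v ×
            (cmDatum L 1 (Matrix.of fun i j : Fin 1 => if i.val + j.val + 1 = 1 then (1 : L) else 0)).Local v) ⧸
          Subgroup.centralizer ({a} : Set ((cmDatum L 2 (Matrix.of fun i j : Fin 2 => if i.val + j.val + 1 = 2 then (1 : L) else 0)).Local v ×
            (cmDatum L 1 (Matrix.of fun i j : Fin 1 => if i.val + j.val + 1 = 1 then (1 : L) else 0)).Local v))) := fun _ _ => borel _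
    letI : ∀ (v : HeightOneSpectrum (𝓞 ↥(maximalRealSubfield L))) (γ : (cmDatum L 3 H).Local v),
        MeasurableSpace ((cmDatum L 3 H).Local v ⧸ Subgroup.centralizer ({γ} : Set ((cmDatum L 3 H).Local v))) := fun _ _ => borel _
    letI : ∀ v : HeightOneSpectrum (𝓞 ↥(maximalRealSubfield L)), MeasurableSpace (Gqs L v ⧸ Subgroup.center (Gqs L v)) := fun _ => borel _
    ∃ (Δ : ∀ v : HeightOneSpectrum (𝓞 ↥(maximalRealSubfield L)), LocalTransferFactor L H v)
      (mH : ∀ v : HeightOneSpectrum (𝓞 ↥(maximalRealSubfield L)),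
    OrbitalMeasureFamily ((cmDatum L 2 (Matrix.of fun i j : Fin 2 => if i.val + j.val + 1 = 2 then (1 : L) else 0)).Local v ×
      (cmDatum L 1 (Matrix.of fun i j : Fin 1 => if i.val + j.val + 1 = 1 then (1 : L) else 0)).Local v))
      (mG : ∀ v : HeightOneSpectrum (𝓞 ↥(maximalRealSubfield L)), OrbitalMeasureFamily ((cmDatum L 3 H).Local v))
      (νG : ∀ v : HeightOneSpectrum (𝓞 ↥(maximalRealSubfield L)), Measure ((cmDatum L 3 H).Local v))
      (νH : ∀ v : HeightOneSpectrum (𝓞 ↥(maximalRealSubfield L)),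
    Measure ((cmDatum L 2 (Matrix.of fun i j : Fin 2 => if i.val + j.val + 1 = 2 then (1 : L) else 0)).Local v ×
      (cmDatum L 1 (Matrix.of fun i j : Fin 1 => if i.val + j.val + 1 = 1 then (1 : L) else 0)).Local v))
      (μZ : ∀ v : HeightOneSpectrum (𝓞 ↥(maximalRealSubfield L)), Measure (Gqs L v ⧸ Subgroup.center (Gqs L v))),
      -- (H₄ᵀ) SHAPE of the kit family's finite packets at non-split places: `packFin ξ v = ⟨πⁿ ∘ e, some πˢ⟩`, Keys labels, `πˢ` supercuspidal, `πˢ ≠ πⁿ ∘ e`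
      -- (the node's local form-congruence binder `T` is spelled `Tv` here, the frame's `T : GL (Fin 3) ℂ` being in scope),
      -- and the identity (13.1.4) for `⟨πⁿ ∘ e, some πˢ⟩` ON TEST FUNCTIONS (the node's SHAPE conjunct at `packFin := (kitFamilyOfRecord 𝔇 …).packFin`, `ξloc := ·.xiLocalChar`)
      (∀ (ξ : OneDimAutRepH L) (v : HeightOneSpectrum (𝓞 ↥(maximalRealSubfield L))),
          (∀ w : PlacesOver L v, IsCMField.complexConj L • w.1 = w.1) →
          ∃ (Tv : GL (Fin 3) (LocalRing L v)) (a : LocalRing L v) (ha : IsUnit a)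
            (h : formCongr (conjLocal L (IsCMField.complexConj L) v) Tv (H.map (algebraMap L (LocalRing L v))) =
              a • (Matrix.of fun i j : Fin 3 => if i.val + j.val + 1 = 3 then (1 : L) else 0).map (algebraMap L (LocalRing L v)))
            (π2 πn : IrrClass (Gqs L v)) (πs : IrrClass ((cmDatum L 3 H).Local v)),
            KeysCaseTwoLabels L v (μω.semilocalComponent L v) (torusLocalComponent L (IsCMField.complexConj L) v ξ.η)
                (torusLocalComponent L (IsCMField.complexConj L) v ξ.ψ) π2 πn ∧
              π2.IsSquareIntegrable (μZ v) ∧ ¬ πn.IsSquareIntegrable (μZ v) ∧ πs.IsSupercuspidal ∧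
              πs ≠ IrrClass.comap (cmDatumLocalCongr L v Tv ha h).symm πn ∧
              (⟨IrrClass.comap (cmDatumLocalCongr L v Tv ha h).symm πn, some πs⟩ : CMLocalAPacket L H v).CharIdentityAtTest L H v
                (fun c f => c.smoothTrace (νG v) f) (ξ.xiLocalChar v) (νH v) (Δ v) (mH v) (mG v) ∧
              (kitFamilyOfRecord 𝔇 L ι H T hT hdef h2 μ μω hμu hμω).packFin ξ v = ⟨IrrClass.comap (cmDatumLocalCongr L v Tv ha h).symm πn, some πs⟩) ∧
      -- (H₅) (H₆) Haar measures: `μZ v` and `νG v`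
      (∀ v : HeightOneSpectrum (𝓞 ↥(maximalRealSubfield L)), (μZ v).IsHaarMeasure) ∧
      (∀ v : HeightOneSpectrum (𝓞 ↥(maximalRealSubfield L)), (νG v).IsHaarMeasure) ∧
      -- (H₇) `φ ↦ φ^H` exists on `C_c^∞` at every non-split finite place [Rogawski1990 Prop. 4.9.1 (a)] (the N6 #102 currency)
      (∀ v : HeightOneSpectrum (𝓞 ↥(maximalRealSubfield L)), (∀ w : PlacesOver L v, IsCMField.complexConj L • w.1 = w.1) →
        IsLocalDeltaTransferExists L H v (Δ v) (mH v) (mG v) Literature.NumberTheory.Rogawski1990.IsLocSmooth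
          Literature.NumberTheory.Rogawski1990.IsLocSmooth) ∧
      -- (H₈ᵀ) the print letter (D-b)ᵀ ON TEST FUNCTIONS, BY NAME, at these data [GelbartRogawski1991 Lem. 5.1.2, Thm. 5.1.1; Rogawski1992 Thm. 1.1]
      (∀ {n' : ℕ} (e₁ : Fin 3 × Fin 1 ≃ Fin n') (dV : Fin 3 → L) (hdV : ∀ i, IsCMField.complexConj L (dV i) = dV i) (hdV0 : ∀ i, dV i ≠ 0) (g : GL (Fin 3) L)
          (hg : ((g : Matrix (Fin 3) (Fin 3) L).map (cmConjRingHom L))ᵀ * H * (g : Matrix (Fin 3) (Fin 3) L) = Matrix.diagonal dV) (ξ : OneDimAutRepH L),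
        Literature.NumberTheory.GelbartRogawski1991.piSCompletion_isThetaTypeAtCMTest L H Δ mH mG νH νG ξ μω (fun v => ξ.xiLocalChar v) e₁ dV hdV hdV0 g hg)) :
    F0P2oD7alphaMemDockStatement.StubD7αMemDockPerMeasureT := by
  intro L _ _ _ ι H T hT hdef h2 μω hμu hμω μ _
  obtain ⟨Δ, mH, mG, νG, νH, μZ, hshape, hHaar, hνG, hex, hW⟩ := hrecT L ι H T hT hdef h2 μω hμu hμω μ
  refine ⟨Δ, mH, mG, νG, νH, fun ξ v => ξ.xiLocalChar v, μZ, (kitFamilyOfRecord 𝔇 L ι H T hT hdef h2 μ μω hμu hμω).packFin, hHaar, hνG, ?_, hshape, ?_⟩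
  · -- DOCKᵀ at the record data: ★ p840326 junction fed H₇ and (D-b)ᵀ H₈ᵀ (borel σ-algebras as in the node's `letI`s)
    intro n' e₁ dV hdV hdV0 g hg ξ
    letI : ∀ v : HeightOneSpectrum (𝓞 ↥(maximalRealSubfield L)), MeasurableSpace ((cmDatum L 3 H).Local v) := fun _ => borel _
    letI : ∀ v : HeightOneSpectrum (𝓞 ↥(maximalRealSubfield L)),
        MeasurableSpace ((cmDatum L 2 (Matrix.of fun i j : Fin 2 => if i.val + j.val + 1 = 2 then (1 : L) else 0)).Local v ×
          (cmDatum L 1 (Matrix.of fun i j : Fin 1 => if i.val + j.val + 1 = 1 then (1 : L) else 0)).Local v) := fun _ => borel _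
    letI : ∀ (v : HeightOneSpectrum (𝓞 ↥(maximalRealSubfield L)))
        (a : ((cmDatum L 2 (Matrix.of fun i j : Fin 2 => if i.val + j.val + 1 = 2 then (1 : L) else 0)).Local v ×
          (cmDatum L 1 (Matrix.of fun i j : Fin 1 => if i.val + j.val + 1 = 1 then (1 : L) else 0)).Local v)),
        MeasurableSpace (((cmDatum L 2 (Matrix.of fun i j : Fin 2 => if i.val + j.val + 1 = 2 then (1 : L) else 0)).Local v ×
            (cmDatum L 1 (Matrix.of fun i j : Fin 1 => if i.val + j.val + 1 = 1 then (1 : L) else 0)).Local v) ⧸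
          Subgroup.centralizer ({a} : Set ((cmDatum L 2 (Matrix.of fun i j : Fin 2 => if i.val + j.val + 1 = 2 then (1 : L) else 0)).Local v ×
            (cmDatum L 1 (Matrix.of fun i j : Fin 1 => if i.val + j.val + 1 = 1 then (1 : L) else 0)).Local v))) := fun _ _ => borel _
    letI : ∀ (v : HeightOneSpectrum (𝓞 ↥(maximalRealSubfield L))) (γ : (cmDatum L 3 H).Local v),
        MeasurableSpace ((cmDatum L 3 H).Local v ⧸ Subgroup.centralizer ({γ} : Set ((cmDatum L 3 H).Local v))) := fun _ _ => borel _
    haveI : ∀ v : HeightOneSpectrum (𝓞 ↥(maximalRealSubfield L)), BorelSpace ((cmDatum L 3 H).Local v) := fun _ => ⟨rfl⟩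
    haveI : ∀ v : HeightOneSpectrum (𝓞 ↥(maximalRealSubfield L)), (νG v).IsHaarMeasure := hνG
    exact F0P2oCharIdentityCompletionUniqueTest.cmThetaDockingClausesTest_of_thetaWitness L H (transpose_map_cmConjRingHom_eq_of_frame L ι H T hT)
      (isUnit_det_of_frame L ι H T hT) Δ mH mG νH νG ξ μω (fun v => ξ.xiLocalChar v) e₁ dV hdV hdV0 g hg hex (hW e₁ dV hdV hdV0 g hg ξ)
  · -- MEM_μ: ★ p839985 §1 at the rows — the packet IS the kit family's
    intro W _ _ σ hirr hsm _hadm P hP hPσ ξ hmem v _hns c hc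
    exact mem_packFin_of_rows 𝔇 h L ι H T hT hdef h2 μ μω hμu hμω W σ hirr hsm P hP hPσ ξ hmem v c hc

end PerMeasureT

end Summit.HodgeConjecture.HodgeConjecture.Cruxes.H413.F0P2oD7alphaMemDockOfRowsT

end
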